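/-
Copyright: H21 programme, solo seat `solo-RiemannHypothesis-informed` (session 6).
-/
import Summits.RiemannHypothesis.RiemannHypothesis.Theorems.SoloInformedCombFlat

/-!
# The comb weight and the comb-weight majorants of `Φ_J` (solo-informed, T39d)

Continuation of `SoloInformedCombFlat`.  With `w(s) = 1/(1+s²)` and the **comb weight**
`W_J(y) = ∑_{|n| ≤ J} w(y + πn)`:

* `W_J(y) ≤ 2π` (`combWeight_le`): `w(s) ≤ 2(arctan(s + π/2) - arctan(s - π/2))` by the mean
  value inequality, and the teeth intervals telescope (`combWeight_le_arctan`);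
* `‖Φ_J(μ)‖ ≤ C_χ · W_J(Im μ)` for `|Re μ| ≤ 1/2` (`norm_combXform_le`);
* `‖Φ_J(μ)‖ ≤ (2 L_q/(πK)^{q-2}) · W_J(Im μ)` for `|Re μ| ≤ 1/2`, `|Im μ| ≥ π(J+K)`, `K ≥ 1`,
  `q ≥ 2` (`norm_combXform_le_far`): beyond the comb every tooth is `≥ πK` away.

These make `ρ ↦ M · W_J(Im ρ - γ₀)` a Cauchy-comb majorant of `|ĝ(ρ)|²` for the bilinear comb
test, summable against the zeros of `ζ` by the local density bound tooth by tooth.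
-/

noncomputable section

open Real MeasureTheory Filter Complex Set Literature.NumberTheory.LFunctions
open scoped Topology ContDiff ComplexConjugate

namespace Summit.RiemannHypothesis.RiemannHypothesis.Theorems

open Companion

/-! ## The comb weight -/

/-- The Cauchy weight `w(s) = 1/(1+s²)`. -/
def combw (s : ℝ) : ℝ := 1 / (1 + s ^ 2)

/-- `0 < w(s)`. -/
theorem combw_pos (s : ℝ) : 0 < combw s := by unfold combw; positivity

/-- `w(s) ≤ 1`. -/
theorem combw_le_one (s : ℝ) : combw s ≤ 1 := by
  unfold combw; rw [div_le_one (by positivity)]; nlinarith [sq_nonneg s]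

/-- The comb weight `W_J(y) = ∑_{|n| ≤ J} w(y + πn)`. -/
def combWeight (J : ℕ) (y : ℝ) : ℝ :=
  combw y + ∑ n ∈ Finset.range J, (combw (y + tooth n) + combw (y - tooth n))

/-- `w(y) ≤ W_J(y)`. -/
theorem combw_le_combWeight (J : ℕ) (y : ℝ) : combw y ≤ combWeight J y := by
  unfold combWeight
  have : 0 ≤ ∑ n ∈ Finset.range J, (combw (y + tooth n) + combw (y - tooth n)) :=
    Finset.sum_nonneg fun n _ ↦ add_nonneg (combw_pos _).le (combw_pos _).le
  linarith

/-- `0 < W_J(y)`. -/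
theorem combWeight_pos (J : ℕ) (y : ℝ) : 0 < combWeight J y :=
  (combw_pos y).trans_le (combw_le_combWeight J y)

/-- `W_{J+1}(y) = W_J(y) + w(y + π(J+1)) + w(y - π(J+1))`. -/
theorem combWeight_succ (J : ℕ) (y : ℝ) :
    combWeight (J + 1) y = combWeight J y + (combw (y + tooth J) + combw (y - tooth J)) := by
  unfold combWeight; rw [Finset.sum_range_succ]; ring

/-- `w(s) ≤ 2 (arctan(s + π/2) - arctan(s - π/2))`. -/
theorem combw_le_arctan (s : ℝ) :
    combw s ≤ 2 * (Real.arctan (s + π / 2) - Real.arctan (s - π / 2)) := by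
  -- mean value inequality on `[s - 1/2, s + 1/2]` for `2 arctan`
  have hD : Convex ℝ (Icc (s - 1 / 2) (s + 1 / 2)) := convex_Icc _ _
  have hf : ContinuousOn (fun t : ℝ ↦ 2 * Real.arctan t) (Icc (s - 1 / 2) (s + 1 / 2)) :=
    (continuous_const.mul Real.continuous_arctan).continuousOn
  have hderiv : ∀ x : ℝ, HasDerivAt (fun t : ℝ ↦ 2 * Real.arctan t) (2 * (1 / (1 + x ^ 2))) x :=
    fun x ↦ (Real.hasDerivAt_arctan x).const_mul 2
  have hf' : DifferentiableOn ℝ (fun t : ℝ ↦ 2 * Real.arctan t)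
      (interior (Icc (s - 1 / 2) (s + 1 / 2))) :=
    fun x _ ↦ (hderiv x).differentiableAt.differentiableWithinAt
  have hge : ∀ x ∈ interior (Icc (s - 1 / 2) (s + 1 / 2)),
      combw s ≤ deriv (fun t : ℝ ↦ 2 * Real.arctan t) x := by
    intro x hx
    rw [interior_Icc] at hx
    rw [(hderiv x).deriv, combw]
    have hx2 : x ^ 2 ≤ 2 * s ^ 2 + 1 := by nlinarith [sq_nonneg (2 * s - x), hx.1, hx.2]
    rw [div_le_iff₀ (by positivity)]
    have e : 2 * (1 / (1 + x ^ 2)) * (1 + s ^ 2) = 2 * (1 + s ^ 2) / (1 + x ^ 2) := by ring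
    rw [e, le_div_iff₀ (by positivity)]
    nlinarith
  have hmv := hD.mul_sub_le_image_sub_of_le_deriv hf hf' hge (s - 1 / 2) ⟨le_rfl, by linarith⟩
    (s + 1 / 2) ⟨by linarith, le_rfl⟩ (by linarith)
  have hlen : combw s * (s + 1 / 2 - (s - 1 / 2)) = combw s := by ring
  rw [hlen] at hmv
  -- enlarge the interval to half-width `π/2 ≥ 1/2`
  have hpi : (1 : ℝ) / 2 ≤ π / 2 := by linarith [Real.pi_gt_three]
  have hm := Real.arctan_strictMono.monotone
  have h1 : Real.arctan (s + 1 / 2) ≤ Real.arctan (s + π / 2) := hm (by linarith)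
  have h2 : Real.arctan (s - π / 2) ≤ Real.arctan (s - 1 / 2) := hm (by linarith)
  linarith

/-- Arctan telescoping: `W_J(y) ≤ 2 (arctan(y + πJ + π/2) - arctan(y - πJ - π/2))`. -/
theorem combWeight_le_arctan (J : ℕ) (y : ℝ) :
    combWeight J y ≤ 2 * (Real.arctan (y + π * J + π / 2) - Real.arctan (y - π * J - π / 2)) := by
  induction J with
  | zero =>
    have h := combw_le_arctan y
    simp only [combWeight, Finset.range_zero, Finset.sum_empty, add_zero, Nat.cast_zero,
      mul_zero, sub_zero]
    exact h
  | succ J ih =>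
    rw [combWeight_succ]
    have h1 := combw_le_arctan (y + tooth J)
    have h2 := combw_le_arctan (y - tooth J)
    have e1 : y + tooth J - π / 2 = y + π * J + π / 2 := by unfold tooth; ring
    have e2 : y + tooth J + π / 2 = y + π * ((J + 1 : ℕ) : ℝ) + π / 2 := by
      unfold tooth; push_cast; ring
    have e3 : y - tooth J + π / 2 = y - π * J - π / 2 := by unfold tooth; ring
    have e4 : y - tooth J - π / 2 = y - π * ((J + 1 : ℕ) : ℝ) - π / 2 := by
      unfold tooth; push_cast; ring
    rw [e1, e2] at h1
    rw [e3, e4] at h2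
    linarith

/-- **Comb weight bound.** `W_J(y) ≤ 2π`. -/
theorem combWeight_le (J : ℕ) (y : ℝ) : combWeight J y ≤ 2 * π := by
  have h := combWeight_le_arctan J y
  have h1 := Real.arctan_lt_pi_div_two (y + π * J + π / 2)
  have h2 := Real.neg_pi_div_two_lt_arctan (y - π * J - π / 2)
  linarith

/-! ## Comb-weight majorants of `Φ_J` -/

/-- `‖X(μ + it)‖ ≤ C_χ w(Im μ + t)` in the strip. -/
theorem norm_chiXform_shift_le {μ : ℂ} (hre : |μ.re| ≤ 1 / 2) (t : ℝ) :
    ‖chiXform (μ + t * I)‖ ≤ combC * combw (μ.im + t) := by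
  have hre' : |(μ + t * I).re| ≤ 1 / 2 := by simpa using hre
  have h := norm_chiXform_le hre'
  have him' : (μ + t * I).im = μ.im + t := by simp
  rw [him'] at h
  rw [combw, ← div_eq_mul_one_div]
  exact h

/-- **Strip majorant.** `‖Φ_J(μ)‖ ≤ C_χ W_J(Im μ)` for `|Re μ| ≤ 1/2`. -/
theorem norm_combXform_le (J : ℕ) {μ : ℂ} (hre : |μ.re| ≤ 1 / 2) :
    ‖combXform J μ‖ ≤ combC * combWeight J μ.im := by
  rw [combXform_eq, combWeight, mul_add, Finset.mul_sum]
  have h0 : ‖chiXform μ‖ ≤ combC * combw μ.im := by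
    have := norm_chiXform_shift_le hre 0
    simpa using this
  refine (norm_add_le _ _).trans (add_le_add h0 ((norm_sum_le _ _).trans
    (Finset.sum_le_sum fun n _ ↦ (norm_add_le _ _).trans ?_)))
  rw [mul_add]
  refine add_le_add (norm_chiXform_shift_le hre (tooth n)) ?_
  have := norm_chiXform_shift_le hre (-tooth n)
  push_cast at this
  rw [neg_mul, ← sub_eq_add_neg, ← sub_eq_add_neg] at this
  exact this

/-- Far off-tooth decay in Cauchy form: for `2 ≤ q`, `1 ≤ D ≤ |Im μ + t|`,
`‖X(μ + it)‖ ≤ (2 L_q / D^{q-2}) w(Im μ + t)`. -/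
theorem norm_chiXform_shift_le_far {q : ℕ} (hq : 2 ≤ q) {μ : ℂ} (hre : |μ.re| ≤ 1 / 2) (t : ℝ)
    {D : ℝ} (hD : 1 ≤ D) (hs : D ≤ |μ.im + t|) :
    ‖chiXform (μ + t * I)‖ ≤ (2 * combL q / D ^ (q - 2)) * combw (μ.im + t) := by
  set s : ℝ := μ.im + t with hs_def
  have hD0 : 0 < D := by linarith
  have hs1 : 1 ≤ |s| := hD.trans hs
  have hs0 : 0 < |s| := by linarith
  have h := norm_chiXform_shift_le_div q hre t hs0 le_rfl
  refine h.trans ?_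
  obtain ⟨r, hr⟩ : ∃ r, q = r + 2 := ⟨q - 2, by omega⟩
  subst hr
  rw [Nat.add_sub_cancel, combw, pow_add]
  have hsq : |s| ^ 2 = s ^ 2 := sq_abs s
  rw [hsq]
  have hL := combL_nonneg (r + 2)
  have hr1 : D ^ r ≤ |s| ^ r := pow_le_pow_left₀ hD0.le hs r
  have hDr : 0 < D ^ r := pow_pos hD0 r
  have hs2 : 1 ≤ s ^ 2 := by nlinarith [hsq, abs_nonneg s]
  have hhalf : (1 : ℝ) / 2 ≤ s ^ 2 / (1 + s ^ 2) := by
    rw [div_le_div_iff₀ (by positivity) (by positivity)]; nlinarith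
  rw [div_le_iff₀ (by positivity)]
  calc combL (r + 2) = (2 * combL (r + 2) / D ^ r) * (D ^ r * (1 / 2)) := by
        field_simp
    _ ≤ (2 * combL (r + 2) / D ^ r) * (|s| ^ r * (s ^ 2 / (1 + s ^ 2))) :=
        mul_le_mul_of_nonneg_left (mul_le_mul hr1 hhalf (by positivity) (by positivity))
          (by positivity)
    _ = 2 * combL (r + 2) / D ^ r * (1 / (1 + s ^ 2)) * (|s| ^ r * s ^ 2) := by
        field_simp

/-- **Far majorant.**  For `2 ≤ q`, `1 ≤ K`, `|Re μ| ≤ 1/2` and `|Im μ| ≥ π(J + K)`: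
`‖Φ_J(μ)‖ ≤ (2 L_q / (πK)^{q-2}) W_J(Im μ)`. -/
theorem norm_combXform_le_far {q J K : ℕ} (hq : 2 ≤ q) (hK : 1 ≤ K) {μ : ℂ}
    (hre : |μ.re| ≤ 1 / 2) (him : π * (J + K) ≤ |μ.im|) :
    ‖combXform J μ‖ ≤ (2 * combL q / (π * K) ^ (q - 2)) * combWeight J μ.im := by
  have hKr : (1 : ℝ) ≤ K := by exact_mod_cast hK
  have hD : (1 : ℝ) ≤ π * K := by nlinarith [Real.pi_gt_three]
  have hdist : ∀ t : ℝ, |t| ≤ π * J → π * K ≤ |μ.im + t| := by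
    intro t ht
    have h1 : |μ.im| - |t| ≤ |μ.im + t| := by
      have := abs_sub_abs_le_abs_sub μ.im (-t)
      rw [abs_neg, sub_neg_eq_add] at this
      exact this
    nlinarith
  set M : ℝ := 2 * combL q / (π * K) ^ (q - 2) with hM
  rw [combXform_eq, combWeight, mul_add, Finset.mul_sum]
  have h0 : ‖chiXform μ‖ ≤ M * combw μ.im := by
    have := norm_chiXform_shift_le_far hq hre 0 hD (hdist 0 (by simp; positivity))
    simpa using this
  refine (norm_add_le _ _).trans (add_le_add h0 ((norm_sum_le _ _).trans
    (Finset.sum_le_sum fun n hn ↦ (norm_add_le _ _).trans ?_)))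
  have hn : (n : ℝ) + 1 ≤ J := by
    have := Finset.mem_range.mp hn
    exact_mod_cast this
  have ht : |tooth n| ≤ π * J := by
    rw [abs_of_pos (tooth_pos n)]; unfold tooth; nlinarith [Real.pi_pos]
  rw [mul_add]
  refine add_le_add (norm_chiXform_shift_le_far hq hre (tooth n) hD (hdist _ ht)) ?_
  have := norm_chiXform_shift_le_far hq hre (-tooth n) hD (hdist _ (by rw [abs_neg]; exact ht))
  push_cast at this
  rw [neg_mul, ← sub_eq_add_neg, ← sub_eq_add_neg] at this
  exact this

end Summit.RiemannHypothesis.RiemannHypothesis.Theorems
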